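import Mathlib.Analysis.Convex.Function
import Mathlib.Analysis.Calculus.Deriv.Basic
import Mathlib.Topology.Order.OrderClosed
import HarnessLib

/-!
# Sharpness of the `h`-uniformity schema: without a modulus, finite-field response data give no order-parameter floor
(cell hubbard-cq, split of record 2026-08-26 15:28Z, row T3 (ii))

Companion of `ResponseModulusSchema.lean` (the schema: data + modulus ⇒ floor). Pure real analysis
over `ConcaveOn`: the class is {`e : ℝ → ℝ` concave and antitone on `[0,∞)`} (every sourced
ground-state energy density `h ↦ e(h)`, finite-`L` or thermodynamic-limit, is in it), the order
parameter of a curve is its CUSP `m* = inf_{s>0} (e 0 − e s)/(2s)` (tree: `dWaveOrderParameter_eq_iInf`),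
and "data at field `h`" means anything determined by `e` near `h` (values, chords, one-sided slopes).

## Contents (critic-2 K1 witness / negation-1 S0 `ε`-lift law, function level)

* the FLAT TRUNCATION `h ↦ min (e h) (e κ)` of a concave antitone curve: concave, antitone, EQUAL to
  `e` at every field `≥ κ`, constant on `[0, κ]` (cusp chords vanish, right derivative `0` at `0`:
  order parameter `0`), and within `e 0 − e κ` of `e` everywhere (`truncation_*`);
* `cuspFloor_nonpos_of_eqOn_Ici` — hence ANY functional of the data at fields `≥ κ` that is a valid
  cusp floor on the class {concave, antitone on `[0,∞)`} is `≤ 0` on the whole class;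
* the `ε`-LIFT `h ↦ min (e 0) (e h + ε)`: concave, antitone, `ε`-close to `e` at EVERY field, equal
  to `e + ε` (identical chords and slopes) wherever the gain `e 0 − e h ≥ ε`, flat near `0`
  (`epsLift_*`); `exists_near_with_cuspFloor_nonpos` — hence every valid cusp floor is `≤ 0` on an
  `ε`-perturbation of every curve, for every `ε > 0`: finite-PRECISION data at ALL fields do not
  floor `m*` either. The matrix/`U1System` realisations are the Barrier files
  `FiniteFieldResponseWithoutLRO.lean` (p457144) and the `ε`-lift follow-up of seat p3.

Not here: the matrix realisations (Barrier files of seat p3), the Goldstone form of the modulus.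
-/

noncomputable section

namespace Summit.Ventures.CertifiedManyBodySolver.Observables

open Set Filter Topology

namespace ResponseModulus

/-! ### §a The flat truncation (critic-2 K1 witness, hubbard-fast `noFloor_truncation`) -/

/-- The flat truncation `h ↦ min (e h) (e κ)` of a concave curve on `[0,∞)` is concave there. -/
theorem truncation_concaveOn {e : ℝ → ℝ} (hc : ConcaveOn ℝ (Ici 0) e) (κ : ℝ) :
    ConcaveOn ℝ (Ici 0) (fun h => min (e h) (e κ)) := by
  have h := hc.inf (concaveOn_const (e κ) (convex_Ici 0))
  refine ⟨h.1, fun x hx y hy a b ha hb hab => ?_⟩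
  simpa [Pi.inf_apply] using h.2 hx hy ha hb hab

/-- … and antitone if `e` is. -/
theorem truncation_antitoneOn {e : ℝ → ℝ} (ha : AntitoneOn e (Ici 0)) (κ : ℝ) :
    AntitoneOn (fun h => min (e h) (e κ)) (Ici 0) :=
  fun _ hx _ hy hxy => min_le_min (ha hx hy hxy) le_rfl

/-- At every field `h ≥ κ ≥ 0` the truncation IS the original curve (identical data there). -/
theorem truncation_eq_self {e : ℝ → ℝ} (ha : AntitoneOn e (Ici 0)) {κ h : ℝ} (hκ : 0 ≤ κ)
    (hh : κ ≤ h) : min (e h) (e κ) = e h :=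
  min_eq_left (ha (mem_Ici.2 hκ) (mem_Ici.2 (hκ.trans hh)) hh)

/-- The truncation agrees with `e` on `[κ, ∞)` (`Set.EqOn` form). -/
theorem truncation_eqOn {e : ℝ → ℝ} (ha : AntitoneOn e (Ici 0)) {κ : ℝ} (hκ : 0 ≤ κ) :
    EqOn (fun h => min (e h) (e κ)) e (Ici κ) :=
  fun _ hh => truncation_eq_self ha hκ hh

/-- On `[0, κ]` the truncation is the constant `e κ`. -/
theorem truncation_eq_const {e : ℝ → ℝ} (ha : AntitoneOn e (Ici 0)) {κ h : ℝ} (hh : 0 ≤ h)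
    (hhκ : h ≤ κ) : min (e h) (e κ) = e κ :=
  min_eq_right (ha (mem_Ici.2 hh) (mem_Ici.2 (hh.trans hhκ)) hhκ)

/-- Hence every cusp chord of the truncation at `s ∈ (0, κ]` VANISHES: its order parameter is `0`. -/
theorem truncation_cuspChord_eq_zero {e : ℝ → ℝ} (ha : AntitoneOn e (Ici 0)) {κ s : ℝ}
    (hs : 0 < s) (hsκ : s ≤ κ) :
    (min (e 0) (e κ) - min (e s) (e κ)) / (2 * s) = 0 := by
  rw [truncation_eq_const ha le_rfl (hs.le.trans hsκ), truncation_eq_const ha hs.le hsκ, sub_self,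
    zero_div]

/-- … and its right derivative at `0` is `0` (`e′(0⁺) = 0`: no cusp), for `κ > 0`. -/
theorem truncation_hasDerivWithinAt_zero {e : ℝ → ℝ} (ha : AntitoneOn e (Ici 0)) {κ : ℝ}
    (hκ : 0 < κ) : HasDerivWithinAt (fun h => min (e h) (e κ)) 0 (Ici 0) 0 := by
  refine (hasDerivWithinAt_const (0 : ℝ) (Ici 0) (e κ)).congr_of_eventuallyEq ?_
    (truncation_eq_const ha le_rfl hκ.le)
  filter_upwards [Icc_mem_nhdsGE hκ] with h hh
  exact truncation_eq_const ha hh.1 hh.2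

/-- The truncation moves the curve by at most the gain `e 0 − e κ` (and only below `κ`). -/
theorem truncation_dist_le {e : ℝ → ℝ} (ha : AntitoneOn e (Ici 0)) {κ h : ℝ} (hκ : 0 ≤ κ)
    (hh : 0 ≤ h) : |min (e h) (e κ) - e h| ≤ e 0 - e κ := by
  rcases le_total κ h with hκh | hhκ
  · rw [truncation_eq_self ha hκ hκh, sub_self, abs_zero]
    exact sub_nonneg.2 (ha (mem_Ici.2 le_rfl) (mem_Ici.2 hκ) hκ)
  · rw [truncation_eq_const ha hh hhκ]
    have h1 : e κ ≤ e h := ha (mem_Ici.2 hh) (mem_Ici.2 (hh.trans hhκ)) hhκ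
    have h2 : e h ≤ e 0 := ha (mem_Ici.2 le_rfl) (mem_Ici.2 hh) hh
    rw [abs_le]
    constructor <;> linarith

/-- **No floor from data at fields `≥ κ` (critic-2 K1 made formal).** Let `G` assign a number to
energy curves, depending only on the curve at fields `≥ κ > 0` (`hG`), and suppose `G` is a valid
order-parameter floor on the class {concave, antitone on `[0,∞)`} in the weak sense that it is below
the cusp chord at `κ` (`hvalid`; every floor on `m* = inf_{s>0}(e 0 − e s)/(2s)` is). Then `G ≤ 0` on
the whole class: the truncation has the same data and cusp chord `0`. -/
theorem cuspFloor_nonpos_of_eqOn_Ici {κ : ℝ} (hκ : 0 < κ) (G : (ℝ → ℝ) → ℝ)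
    (hG : ∀ e₁ e₂ : ℝ → ℝ, EqOn e₁ e₂ (Ici κ) → G e₁ = G e₂)
    (hvalid : ∀ e : ℝ → ℝ, ConcaveOn ℝ (Ici 0) e → AntitoneOn e (Ici 0) →
      G e ≤ (e 0 - e κ) / (2 * κ))
    {e : ℝ → ℝ} (hc : ConcaveOn ℝ (Ici 0) e) (ha : AntitoneOn e (Ici 0)) : G e ≤ 0 := by
  have h1 := hvalid _ (truncation_concaveOn hc κ) (truncation_antitoneOn ha κ)
  rw [truncation_cuspChord_eq_zero ha hκ le_rfl] at h1
  rwa [hG _ e (truncation_eqOn ha hκ.le)] at h1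

/-! ### §b Finite precision: the `ε`-lift (negation-1 S0, function level) -/

/-- The `ε`-lift `h ↦ min (e 0) (e h + ε)` of a concave curve on `[0,∞)` is concave there. -/
theorem epsLift_concaveOn {e : ℝ → ℝ} (hc : ConcaveOn ℝ (Ici 0) e) (ε : ℝ) :
    ConcaveOn ℝ (Ici 0) (fun h => min (e 0) (e h + ε)) := by
  have h := (concaveOn_const (e 0) (convex_Ici 0)).inf (hc.add_const ε)
  refine ⟨h.1, fun x hx y hy a b ha hb hab => ?_⟩
  simpa [Pi.inf_apply] using h.2 hx hy ha hb hab

/-- … and antitone if `e` is. -/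
theorem epsLift_antitoneOn {e : ℝ → ℝ} (ha : AntitoneOn e (Ici 0)) (ε : ℝ) :
    AntitoneOn (fun h => min (e 0) (e h + ε)) (Ici 0) :=
  fun _ hx _ hy hxy => min_le_min le_rfl (by linarith [ha hx hy hxy])

/-- The lift keeps the value at `0` (`ε ≥ 0`). -/
theorem epsLift_zero {e : ℝ → ℝ} {ε : ℝ} (hε : 0 ≤ ε) : min (e 0) (e 0 + ε) = e 0 :=
  min_eq_left (by linarith)

/-- `ε`-closeness at EVERY field `h ≥ 0` (uses only `e h ≤ e 0`). -/
theorem epsLift_dist_le {e : ℝ → ℝ} (ha : AntitoneOn e (Ici 0)) {ε : ℝ} (hε : 0 ≤ ε) {h : ℝ}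
    (hh : 0 ≤ h) : |min (e 0) (e h + ε) - e h| ≤ ε := by
  have hmono : e h ≤ e 0 := ha (mem_Ici.2 le_rfl) (mem_Ici.2 hh) hh
  rw [abs_le]
  constructor
  · rcases le_total (e 0) (e h + ε) with hc | hc
    · rw [min_eq_left hc]; linarith
    · rw [min_eq_right hc]; linarith
  · linarith [min_le_right (e 0) (e h + ε)]

/-- Beyond the crossing (gain `e 0 − e h ≥ ε`) the lift is the original curve shifted by `ε`:
chords and slopes among such fields are IDENTICAL to those of `e`. -/
theorem epsLift_eq_add_of_le_gain {e : ℝ → ℝ} {ε h : ℝ} (hgain : ε ≤ e 0 - e h) :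
    min (e 0) (e h + ε) = e h + ε :=
  min_eq_right (by linarith)

/-- Below the crossing (gain `≤ ε`) the lift is the constant `e 0`. -/
theorem epsLift_eq_of_gain_le {e : ℝ → ℝ} {ε h : ℝ} (hgain : e 0 - e h ≤ ε) :
    min (e 0) (e h + ε) = e 0 :=
  min_eq_left (by linarith)

/-- A concave antitone curve on `[0,∞)` is right-continuous at `0`, quantitatively:
`e 0 − e h ≤ h (e 0 − e 1)` for `0 ≤ h ≤ 1`. -/
theorem gain_le_mul_of_concaveOn {e : ℝ → ℝ} (hc : ConcaveOn ℝ (Ici 0) e) {h : ℝ} (hh : 0 ≤ h)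
    (hh1 : h ≤ 1) : e 0 - e h ≤ h * (e 0 - e 1) := by
  have key := hc.2 (mem_Ici.2 (le_refl (0 : ℝ))) (mem_Ici.2 (zero_le_one : (0 : ℝ) ≤ 1))
    (sub_nonneg.2 hh1) hh (sub_add_cancel 1 h)
  simp only [smul_eq_mul, mul_zero, zero_add, mul_one] at key
  linarith

/-- Hence for every `ε > 0` the lift is FLAT on an initial segment `[0, δ]`, `δ > 0`: all its cusp
chords there vanish — its order parameter is `0`. -/
theorem epsLift_exists_flat {e : ℝ → ℝ} (hc : ConcaveOn ℝ (Ici 0) e) (ha : AntitoneOn e (Ici 0))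
    {ε : ℝ} (hε : 0 < ε) :
    ∃ δ : ℝ, 0 < δ ∧ ∀ s, 0 < s → s ≤ δ →
      (min (e 0) (e 0 + ε) - min (e 0) (e s + ε)) / (2 * s) = 0 := by
  have hD : 0 ≤ e 0 - e 1 := sub_nonneg.2 (ha (mem_Ici.2 le_rfl) (mem_Ici.2 zero_le_one) zero_le_one)
  refine ⟨ε / (e 0 - e 1 + ε), div_pos hε (by linarith), fun s hs hsδ => ?_⟩
  have hs1 : s ≤ 1 := hsδ.trans (by rw [div_le_one (by linarith)]; linarith)
  have hgain : e 0 - e s ≤ ε := by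
    have h1 := gain_le_mul_of_concaveOn hc hs.le hs1
    have h2 : s * (e 0 - e 1) ≤ ε / (e 0 - e 1 + ε) * (e 0 - e 1) :=
      mul_le_mul_of_nonneg_right hsδ hD
    have h3 : ε / (e 0 - e 1 + ε) * (e 0 - e 1) ≤ ε := by
      rw [div_mul_eq_mul_div, div_le_iff₀ (by linarith)]
      nlinarith
    linarith
  rw [epsLift_zero hε.le, epsLift_eq_of_gain_le hgain, sub_self, zero_div]

/-- **No floor from finite-precision data at all fields.** If `G` is a valid order-parameter floor on
the class {concave, antitone on `[0,∞)`} (below every cusp chord), then for every curve `e` of the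
class and every `ε > 0` there is a curve of the class, `ε`-close to `e` at every field and EQUAL to
`e + ε` wherever the gain is `≥ ε` (same response there), on which `G ≤ 0`. -/
theorem exists_near_with_cuspFloor_nonpos (G : (ℝ → ℝ) → ℝ)
    (hvalid : ∀ e : ℝ → ℝ, ConcaveOn ℝ (Ici 0) e → AntitoneOn e (Ici 0) →
      ∀ s, 0 < s → G e ≤ (e 0 - e s) / (2 * s))
    {e : ℝ → ℝ} (hc : ConcaveOn ℝ (Ici 0) e) (ha : AntitoneOn e (Ici 0)) {ε : ℝ} (hε : 0 < ε) :
    ∃ f : ℝ → ℝ, ConcaveOn ℝ (Ici 0) f ∧ AntitoneOn f (Ici 0) ∧ (∀ h, 0 ≤ h → |f h - e h| ≤ ε) ∧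
      (∀ h, ε ≤ e 0 - e h → f h = e h + ε) ∧ G f ≤ 0 := by
  obtain ⟨δ, hδ, hflat⟩ := epsLift_exists_flat hc ha hε
  refine ⟨fun h => min (e 0) (e h + ε), epsLift_concaveOn hc ε, epsLift_antitoneOn ha ε,
    fun h hh => epsLift_dist_le ha hε.le hh, fun h hg => epsLift_eq_add_of_le_gain hg, ?_⟩
  have h1 := hvalid _ (epsLift_concaveOn hc ε) (epsLift_antitoneOn ha ε) δ hδ
  rwa [hflat δ hδ le_rfl] at h1

end ResponseModulus

end Summit.Ventures.CertifiedManyBodySolver.Observables
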